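import Summits.KontsevichZagierPeriods.KontsevichZagierPeriods.Theorems.TerasomaMultiplicationBetaCancellationStubArchimedesRotations

/-!
# `BetaCancellation` (stmt-13633), line `dirichlet-companion-to-pi` — stub `stub_archimedesOfTriangle`

Second half of Archimedes' trisection of the unit disc inside the Kontsevich–Zagier calculus
(first half: `…StubArchimedesRotations.lean`, which produces representations `SB`, `SC` of the
two rotated copies of the slab segment `S_A = D ∩ {x < -1/2}`, with `[S_A] ∼ [SB]`,
`[S_A] ∼ [SC]`). Here: the inscribed equilateral triangle `T` (vertical side `x = -1/2`), the
identity of sets `T ∪ S_B ∪ S_C = (D ∩ {x > -1/2}) ∪ (left edge of T)` with disjoint pieces and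
a null edge, hence in `FormalRep`

  `[D ∩ {x > -1/2}] − [T] − 2·[S_A] ∈ relations`   (`archimedes_trisection`),

and the registered stub `stub_archimedesOfTriangle`: if `[S_A]·c` and `[D ∩ {x > -1/2}]·c` are
relations (what a FIBRED certificate for `[π]·c` yields slab by slab) and `T` is worth the
algebraic constant `3√3/4` against any factor (neighbouring stub `stub_triangleConst`, a
hypothesis here), then `[T]·c ∈ relations`, `scale (3√3/4) c ∈ relations`, `c ∈ relations`.
All representations enter as variables pinned by their domain/integrand equations (no
definitions, no notation).
-/

noncomputable section

-- `Summit.KontsevichZagierPeriods.KontsevichZagierPeriods.…` is the tree's mandated layout (single-conjunct summit).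
set_option linter.dupNamespace false

namespace Summit.KontsevichZagierPeriods.KontsevichZagierPeriods.BetaCancellationLine

open Set MeasureTheory
open Literature.NumberTheory.Transcendental
open Literature.NumberTheory.Transcendental.KZ
open Summit.KontsevichZagierPeriods.KontsevichZagierPeriods.BetaCancellationNegative
  (scale_mem_relations_iff volume_setOf_apply_eq_zero)

/-! ## Elementary inequalities -/

/-- `(√3 y)² = 3 y²`. [folklore] -/
theorem sqrt_three_mul_sq (y : ℝ) : (Real.sqrt 3 * y) ^ 2 = 3 * y ^ 2 := by
  rw [mul_pow, Real.sq_sqrt (by norm_num : (0:ℝ) ≤ 3)]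

/-- On the unit disc, `x ≤ 1`. [folklore] -/
theorem apply_zero_le_one_of_disc {z : Fin 2 → ℝ} (hd : z 0 ^ 2 + z 1 ^ 2 ≤ 1) : z 0 ≤ 1 := by
  nlinarith [sq_nonneg (z 1), sq_nonneg (z 0 - 1)]

/-- A point of the disc beyond the chord `x + √3 y = 1` has `x > -1/2`. [folklore] -/
theorem neg_half_lt_of_segB {z : Fin 2 → ℝ} (hd : z 0 ^ 2 + z 1 ^ 2 ≤ 1)
    (hf : 1 < z 0 + Real.sqrt 3 * z 1) : -(1/2) < z 0 := by
  by_contra h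
  push Not at h
  have h1 : 3/2 < Real.sqrt 3 * z 1 := by linarith
  have h2 : 9/4 < 3 * z 1 ^ 2 := by nlinarith [sqrt_three_mul_sq (z 1)]
  nlinarith

/-- A point of the disc beyond the chord `x − √3 y = 1` has `x > -1/2`. [folklore] -/
theorem neg_half_lt_of_segC {z : Fin 2 → ℝ} (hd : z 0 ^ 2 + z 1 ^ 2 ≤ 1)
    (hf : 1 < z 0 - Real.sqrt 3 * z 1) : -(1/2) < z 0 := by
  by_contra h
  push Not at h
  have h1 : 3/2 < Real.sqrt 3 * (-z 1) := by linarith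
  have h2 : 9/4 < 3 * z 1 ^ 2 := by nlinarith [sqrt_three_mul_sq (-z 1)]
  nlinarith

/-- The two chords' far sides are disjoint in the disc. [folklore] -/
theorem not_segB_and_segC {z : Fin 2 → ℝ} (hd : z 0 ^ 2 + z 1 ^ 2 ≤ 1)
    (hB : 1 < z 0 + Real.sqrt 3 * z 1) (hC : 1 < z 0 - Real.sqrt 3 * z 1) : False := by
  have h1 : 1 < z 0 := by linarith
  have h2 := apply_zero_le_one_of_disc hd
  linarith

/-- A point of the triangle is beyond neither chord (`x + √3 y = 1`). [folklore] -/
theorem not_segB_of_triangle {z : Fin 2 → ℝ} (h2 : z 0 ≤ 1) (h3 : 3 * z 1 ^ 2 ≤ (1 - z 0) ^ 2)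
    (hB : 1 < z 0 + Real.sqrt 3 * z 1) : False := by
  have h4 : 1 - z 0 < Real.sqrt 3 * z 1 := by linarith
  have h5 : (1 - z 0) ^ 2 < 3 * z 1 ^ 2 := by
    have h6 : 0 ≤ 1 - z 0 := by linarith
    nlinarith [sqrt_three_mul_sq (z 1)]
  linarith

/-- A point of the triangle is beyond neither chord (`x − √3 y = 1`). [folklore] -/
theorem not_segC_of_triangle {z : Fin 2 → ℝ} (h2 : z 0 ≤ 1) (h3 : 3 * z 1 ^ 2 ≤ (1 - z 0) ^ 2)
    (hC : 1 < z 0 - Real.sqrt 3 * z 1) : False := by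
  have h4 : 1 - z 0 < Real.sqrt 3 * (-z 1) := by linarith
  have h5 : (1 - z 0) ^ 2 < 3 * z 1 ^ 2 := by
    have h6 : 0 ≤ 1 - z 0 := by linarith
    nlinarith [sqrt_three_mul_sq (-z 1)]
  linarith

/-- The triangle `-1/2 ≤ x ≤ 1`, `3y² ≤ (1-x)²` lies in the unit disc. [folklore] -/
theorem disc_of_triangle {z : Fin 2 → ℝ} (h1 : -1/2 ≤ z 0) (h2 : z 0 ≤ 1)
    (h3 : 3 * z 1 ^ 2 ≤ (1 - z 0) ^ 2) : z 0 ^ 2 + z 1 ^ 2 ≤ 1 := by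
  nlinarith [mul_nonneg (by linarith : (0:ℝ) ≤ 2 * z 0 + 1) (by linarith : (0:ℝ) ≤ 1 - z 0)]

/-- Inside the disc, off both far sides, `3y² ≤ (1-x)²`. [folklore] -/
theorem triangle_of_not_seg {z : Fin 2 → ℝ} (hd : z 0 ^ 2 + z 1 ^ 2 ≤ 1)
    (hB : z 0 + Real.sqrt 3 * z 1 ≤ 1) (hC : z 0 - Real.sqrt 3 * z 1 ≤ 1) :
    3 * z 1 ^ 2 ≤ (1 - z 0) ^ 2 := by
  have _ := hd
  nlinarith [mul_nonneg (sub_nonneg.2 hB) (sub_nonneg.2 hC), sqrt_three_mul_sq (z 1)]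

/-- The line `x = -1/2` is `ℚ`-semialgebraic. [folklore] -/
theorem isSemialgebraic_edgeLine :
    Literature.ModelTheory.ExponentialFields.IsSemialgebraic ℚ {z : Fin 2 → ℝ | z 0 = -1/2} := by
  convert Literature.ModelTheory.ExponentialFields.isSemialgebraic_setOf_eval_eq_zero (k := ℚ) (R := ℝ)
    (MvPolynomial.X 0 + MvPolynomial.C (1/2 : ℚ) : MvPolynomial (Fin 2) ℚ) using 1
  ext z
  simp only [mem_setOf_eq, map_add, MvPolynomial.aeval_X, MvPolynomial.aeval_C, eq_ratCast,
    Rat.cast_div, Rat.cast_one, Rat.cast_ofNat]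
  constructor <;> intro h <;> linarith

/-! ## The cover of `D ∩ {x > -1/2}` by the triangle and the two rotated segments -/

section Triangle

variable {T SB SC : IntegralRep 2}
  (hTd : T.domain = {z : Fin 2 → ℝ | -1/2 ≤ z 0 ∧ z 0 ≤ 1 ∧ 3 * z 1 ^ 2 ≤ (1 - z 0) ^ 2})
  (hSBd : SB.domain = {z : Fin 2 → ℝ | z 0 ^ 2 + z 1 ^ 2 ≤ 1 ∧ 1 < z 0 + Real.sqrt 3 * z 1})
  (hSCd : SC.domain = {z : Fin 2 → ℝ | z 0 ^ 2 + z 1 ^ 2 ≤ 1 ∧ 1 < z 0 - Real.sqrt 3 * z 1})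

include hTd in
/-- The triangle lies in the disc. [folklore] -/
theorem triangle_subset_piDisc : T.domain ⊆ piDisc := by
  intro z hz
  rw [hTd] at hz
  rw [mem_piDisc]
  exact disc_of_triangle hz.1 hz.2.1 hz.2.2

include hSBd in
/-- `S_B` lies in the disc. [folklore] -/
theorem segB_subset_piDisc' : SB.domain ⊆ piDisc := by
  intro z hz
  rw [hSBd] at hz
  rw [mem_piDisc]
  exact hz.1

include hSCd in
/-- `S_C` lies in the disc. [folklore] -/
theorem segC_subset_piDisc' : SC.domain ⊆ piDisc := by
  intro z hz
  rw [hSCd] at hz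
  rw [mem_piDisc]
  exact hz.1

include hTd hSBd hSCd in
/-- **Archimedes' cover as an identity of sets**: `T ∪ S_B ∪ S_C = (D ∩ {x > -1/2}) ∪ (T ∩ {x = -1/2})`.
[folklore] -/
theorem triangle_union_segments_eq :
    T.domain ∪ (SB.domain ∪ SC.domain) =
      (piRep.slabRestrict (-1/2) 2).domain ∪ (T.domain ∩ {z : Fin 2 → ℝ | z 0 = -1/2}) := by
  ext z
  simp only [mem_union, mem_inter_iff, mem_setOf_eq, mem_discR_domain]
  rw [hTd, hSBd, hSCd]
  simp only [mem_setOf_eq]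
  constructor
  · rintro (hT | hB | hC)
    · by_cases h0 : z 0 = -1/2
      · exact Or.inr ⟨hT, h0⟩
      · refine Or.inl ⟨disc_of_triangle hT.1 hT.2.1 hT.2.2,
          lt_of_le_of_ne (by linarith [hT.1]) (fun h => h0 (by linarith [h])), by linarith [hT.2.1]⟩
    · exact Or.inl ⟨hB.1, neg_half_lt_of_segB hB.1 hB.2, by linarith [apply_zero_le_one_of_disc hB.1]⟩
    · exact Or.inl ⟨hC.1, neg_half_lt_of_segC hC.1 hC.2, by linarith [apply_zero_le_one_of_disc hC.1]⟩
  · rintro (⟨hd, h1, _⟩ | ⟨hT, _⟩)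
    · by_cases hB : 1 < z 0 + Real.sqrt 3 * z 1
      · exact Or.inr (Or.inl ⟨hd, hB⟩)
      by_cases hC : 1 < z 0 - Real.sqrt 3 * z 1
      · exact Or.inr (Or.inr ⟨hd, hC⟩)
      push Not at hB hC
      exact Or.inl ⟨by linarith, apply_zero_le_one_of_disc hd, triangle_of_not_seg hd hB hC⟩
    · exact Or.inl hT

variable (hTi : T.integrand = fun _ => 1) (hSBi : SB.integrand = fun _ => 1)
  (hSCi : SC.integrand = fun _ => 1)

include hTd hSBd hSCd hTi hSBi hSCi in
/-- **ARCHIMEDES' TRISECTION in `FormalRep`**: if `[S_A] ∼ [S_B]` and `[S_A] ∼ [S_C]` then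
`[D ∩ {x > -1/2}] − [T] − 2·[S_A] ∈ relations` (three domain-additivity instances, a null edge).
[folklore] -/
theorem archimedes_trisection
    (hAB : of (piRep.slabRestrict (-2) (-1/2)) - of SB ∈ relations)
    (hAC : of (piRep.slabRestrict (-2) (-1/2)) - of SC ∈ relations) :
    of (piRep.slabRestrict (-1/2) 2) - of T - 2 • of (piRep.slabRestrict (-2) (-1/2)) ∈ relations := by
  have hTsub : T.domain ⊆ piDisc := triangle_subset_piDisc hTd
  have hBsub : SB.domain ⊆ piDisc := segB_subset_piDisc' hSBd
  have hCsub : SC.domain ⊆ piDisc := segC_subset_piDisc' hSCd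
  -- the left edge of `T`, the union of the two segments, and the whole cover, as restrictions of `[π]`
  set E : IntegralRep 2 := piRep.restrict (T.domain ∩ {z : Fin 2 → ℝ | z 0 = -1/2})
    (T.isSemialgebraic_domain.inter isSemialgebraic_edgeLine) (fun _ hz => hTsub hz.1) with hE
  set BC : IntegralRep 2 := piRep.restrict (SB.domain ∪ SC.domain)
    (SB.isSemialgebraic_domain.union SC.isSemialgebraic_domain) (union_subset hBsub hCsub) with hBC
  set R : IntegralRep 2 := piRep.restrict (T.domain ∪ (SB.domain ∪ SC.domain))
    (T.isSemialgebraic_domain.union (SB.isSemialgebraic_domain.union SC.isSemialgebraic_domain))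
    (union_subset hTsub (union_subset hBsub hCsub)) with hR
  -- (R1) cover = T ⊔ (S_B ∪ S_C)
  have r1 : of R - of T - of BC ∈ relations := by
    refine domainAddRel_subset_relations ⟨2, R, T, BC, rfl, ?_, fun z _ => ?_, fun _ _ => rfl, rfl⟩
    · refine measure_mono_null (fun z hz => ?_) measure_empty
      obtain ⟨hzT, hzBC⟩ := hz
      rw [hTd] at hzT
      change z ∈ SB.domain ∪ SC.domain at hzBC
      rw [hSBd, hSCd] at hzBC
      rcases hzBC with hzB | hzC
      · exact (not_segB_of_triangle hzT.2.1 hzT.2.2 hzB.2).elim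
      · exact (not_segC_of_triangle hzT.2.1 hzT.2.2 hzC.2).elim
    · rw [hTi]; rfl
  -- (R2) S_B ∪ S_C = S_B ⊔ S_C
  have r2 : of BC - of SB - of SC ∈ relations := by
    refine domainAddRel_subset_relations ⟨2, BC, SB, SC, rfl, ?_, fun z _ => ?_, fun z _ => ?_, rfl⟩
    · refine measure_mono_null (fun z hz => ?_) measure_empty
      obtain ⟨hzB, hzC⟩ := hz
      rw [hSBd] at hzB
      rw [hSCd] at hzC
      exact (not_segB_and_segC hzB.1 hzB.2 hzC.2).elim
    · rw [hSBi]; rfl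
    · rw [hSCi]; rfl
  -- (R3) cover = (D ∩ {x > -1/2}) ⊔ edge
  have r3 : of R - of (piRep.slabRestrict (-1/2) 2) - of E ∈ relations := by
    refine domainAddRel_subset_relations ⟨2, R, piRep.slabRestrict (-1/2) 2, E,
      triangle_union_segments_eq hTd hSBd hSCd, ?_, fun _ _ => rfl, fun _ _ => rfl, rfl⟩
    refine measure_mono_null (fun z hz => ?_) measure_empty
    obtain ⟨hD, hzE⟩ := hz
    rw [mem_discR_domain] at hD
    have h0 : z 0 = -1/2 := hzE.2
    exact absurd hD.2.1 (by rw [h0]; norm_num)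
  -- (R4) the edge is null
  have r4 : of E ∈ relations :=
    of_mem_relations_of_volume_eq_zero _
      (measure_mono_null (fun _ hz => hz.2) (volume_setOf_apply_eq_zero (0 : Fin 2) (-1/2)))
  have e : of (piRep.slabRestrict (-1/2) 2) - of T - 2 • of (piRep.slabRestrict (-2) (-1/2)) =
      (of R - of T - of BC) + (of BC - of SB - of SC) - (of R - of (piRep.slabRestrict (-1/2) 2) - of E)
        - of E - (of (piRep.slabRestrict (-2) (-1/2)) - of SB)
        - (of (piRep.slabRestrict (-2) (-1/2)) - of SC) := by
    rw [two_nsmul]; abel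
  rw [e]
  exact relations.sub_mem (relations.sub_mem (relations.sub_mem (relations.sub_mem
    (relations.add_mem r1 r2) r3) r4) hAB) hAC

include hTd hSBd hSCd hTi hSBi hSCi in
/-- **Slab pieces cancel separately ⟹ the triangle cancels**: if `[S_A]·c` and
`[D ∩ {x > -1/2}]·c` are relations then `[T]·c` is a relation. [folklore] -/
theorem of_triangle_mul_mem
    (hAB : of (piRep.slabRestrict (-2) (-1/2)) - of SB ∈ relations)
    (hAC : of (piRep.slabRestrict (-2) (-1/2)) - of SC ∈ relations)
    {c : FormalRep} (hA : of (piRep.slabRestrict (-2) (-1/2)) * c ∈ relations)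
    (hD : of (piRep.slabRestrict (-1/2) 2) * c ∈ relations) : of T * c ∈ relations := by
  have hX := mul_mem_relations_right_holds _ c (archimedes_trisection hTd hSBd hSCd hTi hSBi hSCi hAB hAC)
  have e : of T * c =
      of (piRep.slabRestrict (-1/2) 2) * c
        - (of (piRep.slabRestrict (-2) (-1/2)) * c + of (piRep.slabRestrict (-2) (-1/2)) * c)
        - (of (piRep.slabRestrict (-1/2) 2) - of T - 2 • of (piRep.slabRestrict (-2) (-1/2))) * c := by
    simp only [sub_mul, add_mul, two_nsmul]; abel
  rw [e]
  exact relations.sub_mem (relations.sub_mem hD (relations.add_mem hA hA)) hX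

end Triangle

/-! ## The triangle is worth `3√3/4`; conclusion -/

/-- **`[T]·c ≡ scale (3√3/4) c`** modulo relations, from the neighbouring stub's equivalence
`s × T ∼ (3√3/4)·s` (biadditivity and commutativity of `×` modulo relations). [folklore] -/
theorem of_triangle_mul_sub_scale_mem (T : IntegralRep 2)
    (hT : ∀ (ha : IsAlgebraic ℚ (3 * Real.sqrt 3 / 4)) (m : ℕ) (s : IntegralRep m),
      Equivalent (s.prod T) (s.constMul (3 * Real.sqrt 3 / 4) ha))
    (c : FormalRep) :
    of T * c - scale (3 * Real.sqrt 3 / 4) isAlgebraic_triangleArea c ∈ relations := by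
  induction c using FreeAbelianGroup.induction_on with
  | zero => simp [relations.zero_mem]
  | of x =>
    obtain ⟨m, s⟩ := x
    change of T * of s - scale _ _ (of s) ∈ relations
    rw [scale_of]
    have h1 := of_mul_of_sub_of_mul_of_mem_relations T s
    have h2 : of s * of T - of (s.constMul _ isAlgebraic_triangleArea) ∈ relations := by
      rw [of_mul_of]; exact hT isAlgebraic_triangleArea m s
    have e : of T * of s - of (s.constMul _ isAlgebraic_triangleArea) =
        (of T * of s - of s * of T) + (of s * of T - of (s.constMul _ isAlgebraic_triangleArea)) := by
      abel
    rw [e]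
    exact relations.add_mem h1 h2
  | neg x ih =>
    have e : of T * -FreeAbelianGroup.of x - scale (3 * Real.sqrt 3 / 4) isAlgebraic_triangleArea
        (-FreeAbelianGroup.of x) =
        -(of T * FreeAbelianGroup.of x - scale (3 * Real.sqrt 3 / 4) isAlgebraic_triangleArea
          (FreeAbelianGroup.of x)) := by
      rw [mul_neg, map_neg]; abel
    rw [e]
    exact relations.neg_mem ih
  | add x y hx hy =>
    have e : of T * (x + y) - scale (3 * Real.sqrt 3 / 4) isAlgebraic_triangleArea (x + y) =
        (of T * x - scale (3 * Real.sqrt 3 / 4) isAlgebraic_triangleArea x) +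
          (of T * y - scale (3 * Real.sqrt 3 / 4) isAlgebraic_triangleArea y) := by
      rw [mul_add, map_add]; abel
    rw [e]
    exact relations.add_mem hx hy

/-- **STUB 3 of the crux skeleton (Archimedes' trisection, lead).** If the triangle `T` is worth
`3√3/4` against any factor, and the two slab pieces `[D ∩ {x < -1/2}]·c`, `[D ∩ {x > -1/2}]·c`
are relations, then `c` is a relation. [folklore] -/
theorem stub_archimedesOfTriangle :
    (∃ T : IntegralRep 2, T.domain = {z : Fin 2 → ℝ | -1/2 ≤ z 0 ∧ z 0 ≤ 1 ∧ 3 * z 1 ^ 2 ≤ (1 - z 0) ^ 2} ∧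
      (T.integrand = fun _ => 1) ∧
      ∀ (ha : IsAlgebraic ℚ (3 * Real.sqrt 3 / 4)) (m : ℕ) (s : IntegralRep m),
        Equivalent (s.prod T) (s.constMul (3 * Real.sqrt 3 / 4) ha)) →
    ∀ c : FormalRep, of (piRep.slabRestrict (-2) (-1/2)) * c ∈ relations →
      of (piRep.slabRestrict (-1/2) 2) * c ∈ relations → c ∈ relations := by
  rintro ⟨T, hTd, hTi, hT⟩ c hA hD
  obtain ⟨SB, SC, hSBd, hSCd, hSBi, hSCi, hAB, hAC⟩ := stub_segmentRotations
  have h1 : of T * c ∈ relations := of_triangle_mul_mem hTd hSBd hSCd hTi hSBi hSCi hAB hAC hA hD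
  have h2 := of_triangle_mul_sub_scale_mem T hT c
  have h3 : scale (3 * Real.sqrt 3 / 4) isAlgebraic_triangleArea c ∈ relations := by
    have := relations.sub_mem h1 h2
    rwa [sub_sub_cancel] at this
  exact (scale_mem_relations_iff isAlgebraic_triangleArea triangleArea_ne_zero c).1 h3

end Summit.KontsevichZagierPeriods.KontsevichZagierPeriods.BetaCancellationLine
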